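import Summits.BirchSwinnertonDyer.BirchSwinnertonDyer.Theorems.CMKolyvaginAtInertTwoLevelZeroPrimeHeegnerBSDTwoOfPrintedInputs
import Summits.BirchSwinnertonDyer.Rank1Residual.X11b.KolyvaginLeafInputsDischarged
import HarnessLib

/-!
# Route `CMKolyvaginAtInertTwo`, crux `CMKolyvaginExactAtInertTwo` (stmt-BirchSwinnertonDyer-24277):
# the H₂ level-zero class theorem with Gross 5.3 DISCHARGED — binders: five BSD-side named facts,
# Gross 3.7 (2) by name, Gross–Zagier III (3.1) as printed, and the two plumbing binders

Seat `bsd-line-cmk2-p1` g9 (cell `bsd-print-cf2`); helper (`--supports stmt-BirchSwinnertonDyer-24277`).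
THEOREMS ONLY (no definition, no named fact, no instance, no `sorry`); no item is closed; BSD is not
proved by this.

`CMLevelZeroTwo.bsdp_two_of_levelZero_primeHeegner_of_printedInputs_of_plumbing` (p638800) with the printed
binder `h53` (Gross 1991 Prop. 5.3 at conductor `m`) DISCHARGED by x11b3's tree theorem
`X11b.KolyvaginLeaves.h53_holds` (`Rank1Residual/X11b/KolyvaginLeafInputsDischarged.lean`: Shimura reciprocity
at conductor `m` on the tree's model of `X₀(N)` + Atkin–Lehner + Manin–Drinfeld). What stays displayed: the
five BSD-side named facts, the named fact `GrossLMS1991.prop37_2_reductionCongruence_inert N_E W K`, ONE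
cite-only printed statement `hGZ31` (Gross–Zagier 1986 III (3.1) in x11b3's `E0Receptacle` shape; at `p = 2`
the Kodaira–Néron discharge `KolyvaginHloc.hGZ_of_kodairaNeron_rat` needs `p ≠ 2` — the Tamagawa road under
`Odd W.tamagawaProduct` is ty2 g23's task), and the two PLUMBING binders (tower), (desc-fin) — themselves tree
theorems (ty2 g22, `Rank1Residual.P2.RationalDescentPlumbing.htower_two_pow_one` / `hdescfin_two_pow_one`,
p636109; the sibling file `…LevelZeroPrimeHeegnerBSDTwoOfPrint` plugs them in once that module is built on the
farm).

* `bsdp_two_of_levelZero_primeHeegner_of_twoPrints_of_plumbing` — PRINTS {modularity, Gross–Zagier all levels,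
  GZK, Milne any-model, Burungale–Flach; Gross 3.7 (2) by name; GZ III (3.1)} → ∀ `W ∈ H₂` (`HasCM`,
  `CMInert W 2`, `ρ̄₂` onto, `r_an = 1`, odd Tamagawa, globally minimal) → ∀ `K` imaginary quadratic with
  `d_K = −q` (`q` prime) odd `≠ −3`, Heegner for `N_E` → ∀ frame with `y_K` of infinite order, `y_K ∉ 2E(K[1])`
  → (place `u` of `q`, (tower), (desc-fin)) → `BSDp W 2`.

HONEST FRAMING: conditional on the displayed prints and the two plumbing binders; beyond print: the
STATEMENT has no printed counterpart (`p` odd in Kolyvagin / McCallum / Cha / Matar–Nekovář; barrier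
`CMRankOneAtNonsplitTwo`), no new mathematics is claimed — referee's call at booking. BSD is not proved by
this; no summit statement and no item is closed by this file.

References: [GrossLMS1991] §1 (1.2), Prop. 2.1, Props. 3.7, 5.3, 5.4, 6.2, §10; [McCallumLMS1991] §§1–5;
[GrossZagier1986] I.6.3, III (3.1), V.§2; [BurungaleFlach2024] Thm. 1.1, Cor. 2; [Milne1972] Thm. 1;
[MilneADT2006] I Prop. 3.8, Thm. 4.10 (b); [Darmon2004] Thm. 3.6–3.7; [Gross1984] §5.
-/

-- single-conjunct summit: `Summit.BirchSwinnertonDyer.BirchSwinnertonDyer.…` repeats the name by design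
set_option linter.dupNamespace false
set_option autoImplicit false

noncomputable section

open scoped Classical
open WeierstrassCurve NumberField IsDedekindDomain
open Literature.NumberTheory.EllipticCurves Literature.NumberTheory.EllipticCurves.ModularForms
open Literature.NumberTheory.EllipticCurves.Rank1Residual
open Literature.NumberTheory.EllipticCurves.RingClassField
open Literature.NumberTheory.GaloisRepresentations
open Summit.BirchSwinnertonDyer.Rank1Residual.X11b
open Rat.HeightOneSpectrum (primesEquiv)

namespace Summit.BirchSwinnertonDyer.BirchSwinnertonDyer.Theorems.CMLevelZeroTwo

/-- **The H₂ level-zero class theorem with Gross 5.3 discharged** (module docstring): the five BSD-side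
named facts, Gross 3.7 (2) by name, Gross–Zagier III (3.1) as printed and the two plumbing binders imply `BSD₂(W)` for every `W ∈ H₂` with a prime Heegner field `K = ℚ(√−q)` and a
frame whose `y_K` has infinite order and is not `2`-divisible in `E(K[1])`.
[cite: GrossLMS1991, §1 (1.2), Prop. 2.1 with §10, Props. 3.7, 5.3, 5.4, 6.2] [cite: McCallumLMS1991, §1
Theorem, §2 Prop. 2.2, §4 Prop. 4.4, §5 Lemma 5.1] [cite: GrossZagier1986, Thm. I.6.3, III (3.1), V.§2]
[cite: BurungaleFlach2024, Thm. 1.1 and Cor. 2] [cite: Milne1972ArithmeticAV, §1 Thm. 1] -/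
theorem bsdp_two_of_levelZero_primeHeegner_of_twoPrints_of_plumbing (hmod : exists_isNewformOf)
    (hGZall : ∀ (N : ℕ) [NeZero N] (W : WeierstrassCurve ℚ) (K : Type) [Field K] [NumberField K],
      gross_zagier N W K)
    (hGZK : rank_eq_analyticRank_of_analyticRank_le_one)
    (hMilne : Milne1972.bsdQuotient_baseChange_quadratic_anyModel)
    (hBF : bsdTriple_of_hasCM_of_L_one_ne_zero)
    (W : WeierstrassCurve ℚ) [W.IsElliptic] [W.IsGloballyMinimal] [NeZero (W.conductorNorm ℤ)]
    (hCM : W.HasCM) (hin : CMInert W 2) (hsurj : W.HasSurjectiveModNGaloisRep (2 : ℤ))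
    (hr : W.analyticRank = 1) (hT : Odd W.tamagawaProduct)
    (K : Type) [Field K] [NumberField K] (hK : IsImaginaryQuadratic K) (hodd : Odd (discr K))
    (h3 : discr K ≠ -3) (hH : SatisfiesHeegnerHypothesis (W.conductorNorm ℤ) K)
    {q : ℕ} (hq : q.Prime) (hd : discr K = -(q : ℤ))
    (h372 : GrossLMS1991.prop37_2_reductionCongruence_inert (W.conductorNorm ℤ) W K)
    (hGZ31 : ∀ [W.IsElliptic] (_hK : IsImaginaryQuadratic K) (_hH : SatisfiesHeegnerHypothesis (W.conductorNorm ℤ) K)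
      (Dt : ModularParametrizationData W (W.conductorNorm ℤ)) (β : ℤ) (ι : K →+* ℂ) {M : ℕ} (_hM : 1 ≤ M) {n : ℕ}
      (_hn : Squarefree n)
      (_hKol : ∀ q ∈ n.primeFactors, IsKolyvaginPrime (W.conductorNorm ℤ) W K 2 q ∧ FrobEqFrobInfty W K (2 ^ M) q)
      (d : (m : ℕ) → m ∣ n → KolyvaginHeegnerData Dt β ι m),
      ∃ n' : ℤ, IsCoprime ((2 ^ M : ℕ) : ℤ) n' ∧
        ∀ (m : ℕ) (hm : m ∣ n) (γ : ringClassField K ι m ≃ₐ[ℚ] ringClassField K ι m),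
          γ ∈ ringClassGal ι m → ∀ v : HeightOneSpectrum (𝓞 K),
            ¬ (W.baseChange K).HasGoodReductionAt v →
            n' • pointsMap (W.baseChange K) (v.adicCompletion K)
                ((d m hm).toGeomPoints (pointGalHom W (ringClassField K ι m) γ (d m hm).y)) ∈
              E0Receptacle (W.baseChange K) v ∧
            ∀ (ℓ : ℕ) (hℓ : ℓ ∈ m.primeFactors)
              (hle : ringClassField K ι (m / ℓ) ≤ ringClassField K ι m),
              n' • pointsMap (W.baseChange K) (v.adicCompletion K)
                  ((d m hm).toGeomPoints (pointGalHom W (ringClassField K ι m) γ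
                    (WeierstrassCurve.Affine.Point.map (W' := W)
                      ((RingClassField.inclusion ι hle).restrictScalars ℚ)
                      (d (m / ℓ)
                        ((Nat.div_dvd_of_dvd (Nat.dvd_of_mem_primeFactors hℓ)).trans hm)).y))) ∈
                E0Receptacle (W.baseChange K) v)
    (Dt : ModularParametrizationData W (W.conductorNorm ℤ))
    (hopt : ∀ z ∈ Dt.L.lattice, ∃ w ∈ periodLattice Dt.f, z = (Dt.c : ℂ) * w) (hc : Odd Dt.c)
    (β : ℤ) (ι : K →+* ℂ) (d₁ : KolyvaginHeegnerData Dt β ι 1) (hy : ¬ IsOfFinAddOrder d₁.derivedPoint)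
    (h2 : ¬ ∃ Q : (W.baseChange (ringClassField K ι 1)).toAffine.Point, (2 : ℤ) • Q = d₁.derivedPoint)
    (u : HeightOneSpectrum (𝓞 ℚ)) (hu : ((primesEquiv u : Nat.Primes) : ℕ) = q)
    (htower : ∀ (w : HeightOneSpectrum (𝓞 K)) (ξ : galH1Torsion W ((2 ^ 1 : ℕ) : ℤ)),
      ξ ∈ W.torsionLocalKer ((w.under (𝓞 ℚ)).adicCompletion ℚ) ((2 ^ 1 : ℕ) : ℤ) →
        resTorsion W K ((2 ^ 1 : ℕ) : ℤ) ξ ∈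
          (W.baseChange K).torsionLocalKer (w.adicCompletion K) ((2 ^ 1 : ℕ) : ℤ))
    (hdescfin : ∀ (ξ : galH1Torsion W ((2 ^ 1 : ℕ) : ℤ)) (v : HeightOneSpectrum (𝓞 ℚ)), v ≠ u →
      (∀ w : HeightOneSpectrum (𝓞 K), w.under (𝓞 ℚ) = v →
        resTorsion W K ((2 ^ 1 : ℕ) : ℤ) ξ ∈
          selmerLocalKer (W.baseChange K) (w.adicCompletion K) ((2 ^ 1 : ℕ) : ℤ)) →
      ξ ∈ selmerLocalKer W (v.adicCompletion ℚ) ((2 ^ 1 : ℕ) : ℤ)) :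
    BSDp W 2 :=
  bsdp_two_of_levelZero_primeHeegner_of_printedInputs_of_plumbing hmod hGZall hGZK hMilne hBF W
    hCM hin hsurj hr hT K hK hodd h3 hH hq hd u hu h372 (KolyvaginLeaves.h53_holds rfl 2) hGZ31 Dt hopt hc β ι d₁ hy
    h2 htower hdescfin

end Summit.BirchSwinnertonDyer.BirchSwinnertonDyer.Theorems.CMLevelZeroTwo

end
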